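import Summits.CriticalPhenomena.PercolationContinuityZ3.Theorems.PercNearOneGluingNoHeavyLowerTailSahiThreeCopyPolarizationCases

/-!
# `NoHeavyLowerTail` (crux stmt-CriticalPhenomena-4575), Sahi programme: **THE SLICE LAW ON ONE CUBE** — the (SC)-excess as an
# explicit functional `E_b(u,v,w | f,g,h)` of SIX functions on `{0,1}^d`, its faces (diagonal = `c_b`, AND-corner = 0, one slot
# lowered = `c_b` of the lowered triple, AND-face ≥ 0 by three Harris steps, free-slot face = the pair step), the equivalence
# `SliceLaw ↔ [E_b ≥ 0 for all nested monotone data]`, the pair-step law (PS) with `(SC) ⇒ (PS) ⇒ 3C-SAHI`, and the LIFTING REMARK: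
# every retention bound `λ·c_b(t¹) ≤ c_{(2,b)}` with a fixed `λ < 3` already gives 3C-SAHI outright (no induction on the dimension)

Support file (Sahi cell, seat `prim-sahi-p1`, generation 58; `--supports stmt-CriticalPhenomena-4575`); companion of `…SahiThreeCopySliceLaw`,
`…SliceLawCases`, `…Polarization(Cases)`.  Pure proofs and one `@[conjecture] def` (`PairStepLaw`, OPEN, used only as a hypothesis);
no `sorry`, standard axioms.

THE POINT.  `(SC)` (`SliceLaw`: `2·c_b(F¹,G¹,H¹) ≤ c_{(2,b)}(F,G,H)` for monotone triples on `{0,1}^{d+1}`) is a statement about the SIX sections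
`u = F⁰ ≤ f = F¹`, `v = G⁰ ≤ g = G¹`, `w = H⁰ ≤ h = H¹` on `{0,1}^d`, and conversely every such sextuple of nonnegative monotone functions
glues to a monotone triple (`glue`).  Written out (`scx`, all data real; `tc_cons_two_sub_two_eq_scx`):
`c_{(2,b)} − 2c_b(f,g,h) = E_b(u,v,w|f,g,h) := Σ_cyc [N(f;gh;1) − N(u;gh;1)] − 2N(f;g;h) + [N(u;g;h) + N(f;v;h) + N(f;g;w)]
 − [N(f;vw;1) + N(g;uw;1) + N(h;uv;1)] + 2N(uvw;1;1)`,
multi-affine in `(u,v,w)`.  So `SliceLaw ↔ ∀ d b, ∀ 0 ≤ u ≤ f, 0 ≤ v ≤ g, 0 ≤ w ≤ h monotone, 0 ≤ E_b` (`sliceLaw_iff_oneLevel`) — ONE cube, no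
sections.  Faces: `E(f,g,h|f,g,h) = c_b(f,g,h)` (`scx_diag`); `E(u,g,h|f,g,h) = c_b(u,g,h)` (`scx_lower_one`, so the EDGES out of the corner
`(0,g,h)` are 3C-SAHI instances and `E(0,g,h|…) = 0`: (SC) is tight at every AND-literal slot, `scx_and_corner`); the AND-FACE
`E(0,v,w|f,g,h) = N(f; gh − vw; 1) + [N(g−v; fh; 1) − N(f; g−v; h)] + [N(h−w; fg; 1) − N(f; g; h−w)] ≥ 0` (`scx_zero_left(_nonneg)`: one
positivity + two three-copy Harris steps — the one-cube form of `sliceLaw_andAdj`); the FREE FACE `E(f,v,w|f,g,h) = c_b(f,v,w) + Y_b(f; g−v, h−w)`,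
`Y(f;p,q) = N(p;fq;1) + N(q;fp;1) − N(f;p;q)` (`scx_full_left`) — the PAIR STEP of memo gen56 §2bis.  `PairStepLaw` (PS, OPEN) is that face's
nonnegativity; `pairStepLaw_of_sliceLaw : SliceLaw → PairStepLaw` (a face) and `threeCopySahi_of_pairStepLaw : PairStepLaw → ThreeCopySahi`
(the sub-face `v = g, w = h` IS 3C), so (PS) is a weaker sufficient target than (SC).  LIFTING (`threeCopySahi_of_retention`): if for some
fixed real `λ < 3` every monotone triple satisfies `λ·c_b(F¹,G¹,H¹) ≤ c_{(2,b)}(F,G,H)`, then 3C-SAHI holds — apply it to `x₀`-free lifts, where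
`c_{(2,b)} = 3c_b` (`tc_cons_two_lift`); (SC) is `λ = 2` (sharp: attained at AND-literal slots), and the induction on `d` of
`threeCopySahi_of_sliceLaw` is not needed.  ORDER TWO for contrast (`harris3_cons_one/two`): the three-copy Harris gap
`H_b(f,g) = N_b(fg;1;1) − N_b(f;g;1)` satisfies the EXACT superadditivity `H_{(1,b)} = 2H_b(t⁰) + H_b(t¹) + N_b(δf;δg;1)`,
`H_{(2,b)} = H_b(t⁰) + 2H_b(t¹) + N_b(δf;δg;1)`; at order three the analogue `c_{(1,b)} ≥ c_{(0,b)} + c_{(3,b)}` is `(SC) + tc_cons_alt`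
(`tc_cons_one_superadditive_of_sliceLaw`).  [this work; memo FROM-prim-sahi-p1-gen58]
-/

namespace Summit.CriticalPhenomena.PercolationContinuityZ3.Theorems.SahiThreeCopy

open Finset Function Literature.Combinatorics.Sahi2008
open scoped BigOperators

noncomputable section

variable {d : ℕ}

/-! ### §1 The one-cube excess functional -/

/-- **`E_b(u,v,w | f,g,h)`** — the (SC)-excess `c_{(2,b)} − 2c_b(f,g,h)` written on one cube in terms of the bottom sections
`(u,v,w)` and the top sections `(f,g,h)` (all data real; multi-affine in `u, v, w`). [this work] -/
def scx (b : Fin d → ℕ) (u v w f g h : Pt d → ℝ) : ℝ :=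
  (N3 b f (g * h) 1 - N3 b u (g * h) 1) + (N3 b g (f * h) 1 - N3 b v (f * h) 1) + (N3 b h (f * g) 1 - N3 b w (f * g) 1)
  - 2 * N3 b f g h + (N3 b u g h + N3 b f v h + N3 b f g w)
  - (N3 b f (v * w) 1 + N3 b g (u * w) 1 + N3 b h (u * v) 1) + 2 * N3 b (u * v * w) 1 1

/-- ★ **`c_{(2,b)}(F,G,H) − 2c_b(F¹,G¹,H¹) = E_b(F⁰,G⁰,H⁰ | F¹,G¹,H¹)`** (all data real). [this work] -/
theorem tc_cons_two_sub_two_eq_scx (b : Fin d → ℕ) (F G H : Pt (d + 1) → ℝ) :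
    tc (Fin.cons 2 b : Fin (d + 1) → ℕ) F G H - 2 * tc b (sec F true) (sec G true) (sec H true) =
      scx b (sec F false) (sec G false) (sec H false) (sec F true) (sec G true) (sec H true) := by
  rw [tc_cons_two_pol]
  unfold tcp6 tc scx
  ring

/-- The polarized form: `E_b(u,v,w|f,g,h) = ½·6T_b((u,v,w);t;t) − 2c_b(t)`. [this work] -/
theorem scx_eq_tcp6 (b : Fin d → ℕ) (u v w f g h : Pt d → ℝ) :
    scx b u v w f g h = (1 / 2 : ℝ) * tcp6 b u v w f g h f g h - 2 * tc b f g h := by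
  unfold tcp6 tc scx
  ring

/-- DIAGONAL: `E_b(f,g,h | f,g,h) = c_b(f,g,h)` — on `x₀`-free lifts the slice law is `3c ≥ 2c`. [this work] -/
theorem scx_diag (b : Fin d → ℕ) (f g h : Pt d → ℝ) : scx b f g h f g h = tc b f g h := by
  unfold scx tc; ring

/-- ONE SLOT LOWERED: `E_b(u,g,h | f,g,h) = c_b(u,g,h)` — the edges of the box leaving the AND-corner are 3C-SAHI instances
(one-cube form of `tcp6_lower_one`). [this work] -/
theorem scx_lower_one (b : Fin d → ℕ) (u f g h : Pt d → ℝ) : scx b u g h f g h = tc b u g h := by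
  unfold scx tc; ring

/-- AND-CORNER: `E_b(0,g,h | f,g,h) = 0` — (SC) is TIGHT whenever one slot is an AND-literal and the others are `x₀`-free. [this work] -/
theorem scx_and_corner (b : Fin d → ℕ) (f g h : Pt d → ℝ) : scx b 0 g h f g h = 0 := by
  rw [scx_lower_one, tc_zero_left]

/-- ZERO COPY: `E_b(0,0,0 | f,g,h) = Σ_cyc N_b(f;gh;1) − 2N_b(f;g;h)` (the Harris slack of `tcp6_zero_copy_ge`). [this work] -/
theorem scx_zero_copy (b : Fin d → ℕ) (f g h : Pt d → ℝ) :
    scx b 0 0 0 f g h = N3 b f (g * h) 1 + N3 b g (f * h) 1 + N3 b h (f * g) 1 - 2 * N3 b f g h := by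
  unfold scx
  have h1 : N3 b (0 : Pt d → ℝ) (g * h) 1 = 0 := N3_zero_left b _ _
  have h2 : N3 b (0 : Pt d → ℝ) (f * h) 1 = 0 := N3_zero_left b _ _
  have h3 : N3 b (0 : Pt d → ℝ) (f * g) 1 = 0 := N3_zero_left b _ _
  have h4 : N3 b (0 : Pt d → ℝ) g h = 0 := N3_zero_left b _ _
  have h5 : N3 b f (0 : Pt d → ℝ) h = 0 := by rw [N3_comm12, N3_zero_left]
  have h6 : N3 b f g (0 : Pt d → ℝ) = 0 := by rw [N3_comm13, N3_zero_left]
  have h7 : N3 b f ((0 : Pt d → ℝ) * 0) 1 = 0 := by rw [mul_zero, N3_comm12, N3_zero_left]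
  have h8 : N3 b g ((0 : Pt d → ℝ) * 0) 1 = 0 := by rw [mul_zero, N3_comm12, N3_zero_left]
  have h9 : N3 b h ((0 : Pt d → ℝ) * 0) 1 = 0 := by rw [mul_zero, N3_comm12, N3_zero_left]
  have h10 : N3 b ((0 : Pt d → ℝ) * 0 * 0) 1 1 = 0 := by simp only [mul_zero]; exact N3_zero_left b 1 1
  rw [h1, h2, h3, h4, h5, h6, h7, h8, h9, h10]
  ring

/-! ### §2 (SC) on one cube -/

/-- ★ **The slice law on one cube**: `SliceLaw ↔` for every dimension `d`, profile `b` and nonnegative monotone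
`u ≤ f`, `v ≤ g`, `w ≤ h` on `{0,1}^d`, `0 ≤ E_b(u,v,w | f,g,h)`.  (Forward: glue the pairs to monotone functions on `{0,1}^{d+1}`;
backward: take sections.) [this work] -/
theorem sliceLaw_iff_oneLevel : SliceLaw ↔
    ∀ (d : ℕ) (b : Fin d → ℕ) (u v w f g h : Pt d → ℝ), (∀ x, 0 ≤ u x) → (∀ x, 0 ≤ v x) → (∀ x, 0 ≤ w x) →
      (∀ x, u x ≤ f x) → (∀ x, v x ≤ g x) → (∀ x, w x ≤ h x) →
      Monotone u → Monotone v → Monotone w → Monotone f → Monotone g → Monotone h → 0 ≤ scx b u v w f g h := by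
  constructor
  · intro hSC d b u v w f g h hu hv hw huf hvg hwh hum hvm hwm hfm hgm hhm
    have hf : ∀ x, 0 ≤ f x := fun x => (hu x).trans (huf x)
    have hg : ∀ x, 0 ≤ g x := fun x => (hv x).trans (hvg x)
    have hh : ∀ x, 0 ≤ h x := fun x => (hw x).trans (hwh x)
    have key := hSC d b (glue u f) (glue v g) (glue w h) (glue_nonneg hu hf) (glue_nonneg hv hg) (glue_nonneg hw hh)
      (glue_monotone hum hfm huf) (glue_monotone hvm hgm hvg) (glue_monotone hwm hhm hwh)
    have e := tc_cons_two_sub_two_eq_scx b (glue u f) (glue v g) (glue w h)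
    simp only [sec_glue_false, sec_glue_true] at key e
    linarith
  · intro H d b F G H' hF hG hH hFm hGm hHm
    have key := H d b (sec F false) (sec G false) (sec H' false) (sec F true) (sec G true) (sec H' true)
      (sec_nonneg hF false) (sec_nonneg hG false) (sec_nonneg hH false)
      (sec_false_le_sec_true hFm) (sec_false_le_sec_true hGm) (sec_false_le_sec_true hHm)
      (sec_monotone hFm false) (sec_monotone hGm false) (sec_monotone hHm false)
      (sec_monotone hFm true) (sec_monotone hGm true) (sec_monotone hHm true)
    have e := tc_cons_two_sub_two_eq_scx b F G H'
    linarith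

/-! ### §3 The AND-face: one slot an AND-literal, the other two ARBITRARY nested pairs -/

/-- The AND-face in closed form: `E_b(0,v,w | f,g,h) = N_b(f; gh − vw; 1) + [N_b(g−v; fh; 1) − N_b(f; g−v; h)] + [N_b(h−w; fg; 1) − N_b(f; g; h−w)]`
(all data real). [this work] -/
theorem scx_zero_left (b : Fin d → ℕ) (v w f g h : Pt d → ℝ) :
    scx b 0 v w f g h = N3 b f (g * h - v * w) 1 + (N3 b (g - v) (f * h) 1 - N3 b f (g - v) h)
      + (N3 b (h - w) (f * g) 1 - N3 b f g (h - w)) := by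
  unfold scx
  have h1 : N3 b (0 : Pt d → ℝ) (g * h) 1 = 0 := N3_zero_left b _ _
  have h4 : N3 b (0 : Pt d → ℝ) g h = 0 := N3_zero_left b _ _
  have h8 : N3 b g ((0 : Pt d → ℝ) * w) 1 = 0 := by rw [zero_mul, N3_comm12, N3_zero_left]
  have h9 : N3 b h ((0 : Pt d → ℝ) * v) 1 = 0 := by rw [zero_mul, N3_comm12, N3_zero_left]
  have h10 : N3 b ((0 : Pt d → ℝ) * v * w) 1 1 = 0 := by rw [zero_mul, zero_mul, N3_zero_left]
  rw [h1, h4, h8, h9, h10, N3_sub_mid, N3_sub_left, N3_sub_mid, N3_sub_left, N3_sub_right]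
  ring

/-- ★ **(SC) on the AND-face, unconditionally**: `0 ≤ E_b(0,v,w | f,g,h)` for nonnegative `v ≤ g`, `w ≤ h` and nonnegative MONOTONE
`f, g, h` (no monotonicity of `v, w` needed): one positivity (`gh ≥ vw`) and two three-copy Harris steps with the nonnegative spectators
`g − v`, `h − w`.  The one-cube form of `sliceLaw_andAdj`. [this work] -/
theorem scx_zero_left_nonneg (b : Fin d → ℕ) {v w f g h : Pt d → ℝ} (hv : ∀ x, 0 ≤ v x) (hw : ∀ x, 0 ≤ w x)
    (hvg : ∀ x, v x ≤ g x) (hwh : ∀ x, w x ≤ h x) (hf : ∀ x, 0 ≤ f x) (hfm : Monotone f) (hgm : Monotone g) (hhm : Monotone h) :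
    0 ≤ scx b 0 v w f g h := by
  have hg : ∀ x, 0 ≤ g x := fun x => (hv x).trans (hvg x)
  have hh : ∀ x, 0 ≤ h x := fun x => (hw x).trans (hwh x)
  have one_nn : ∀ x : Pt d, (0 : ℝ) ≤ (1 : Pt d → ℝ) x := fun _ => zero_le_one
  rw [scx_zero_left]
  have P1 : 0 ≤ N3 b f (g * h - v * w) 1 := by
    refine N3_nonneg b hf (fun x => ?_) one_nn
    simp only [Pi.sub_apply, Pi.mul_apply]
    nlinarith [hv x, hw x, hvg x, hwh x]
  -- Harris with spectator `g − v ≥ 0`: `N(f; g−v; h) = N(f; h; g−v) ≤ N(fh; 1; g−v) = N(g−v; fh; 1)`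
  have A1 : N3 b f h (g - v) ≤ N3 b (f * h) 1 (g - v) :=
    N3_le_N3_mul d b f h (g - v) hf hfm hh hhm fun x => sub_nonneg.2 (hvg x)
  have e1 : N3 b f (g - v) h = N3 b f h (g - v) := N3_comm23 b f (g - v) h
  have e2 : N3 b (g - v) (f * h) 1 = N3 b (f * h) 1 (g - v) := by rw [N3_comm12, N3_comm23]
  have A2 : N3 b f g (h - w) ≤ N3 b (f * g) 1 (h - w) :=
    N3_le_N3_mul d b f g (h - w) hf hfm hg hgm fun x => sub_nonneg.2 (hwh x)
  have e3 : N3 b (h - w) (f * g) 1 = N3 b (f * g) 1 (h - w) := by rw [N3_comm12, N3_comm23]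
  linarith

/-! ### §4 The free face: the pair step (PS) -/

/-- The FREE FACE in closed form: with `p = g − v`, `q = h − w`,
`E_b(f,v,w | f,g,h) = c_b(f,v,w) + [N_b(p; fq; 1) + N_b(q; fp; 1) − N_b(f; p; q)]` (all data real) — the pair step of memo gen56 §2bis
(`c(f,G⁰,H⁰) + Y(f;δG,δH)`), now on one cube. [this work] -/
theorem scx_full_left (b : Fin d → ℕ) (v w f g h : Pt d → ℝ) :
    scx b f v w f g h = tc b f v w + (N3 b (g - v) (f * (h - w)) 1 + N3 b (h - w) (f * (g - v)) 1 - N3 b f (g - v) (h - w)) := by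
  unfold scx tc
  simp only [mul_sub, N3_sub_left, N3_sub_mid, N3_sub_right]
  ring

/-- **(PS) THE PAIR-STEP LAW** (memo FROM-prim-sahi-p1-gen56 §2bis; OPEN): for every dimension `d`, profile `b`, nonnegative monotone `f`, and
nonnegative monotone `v ≤ g`, `w ≤ h` on `{0,1}^d`: `0 ≤ E_b(f,v,w | f,g,h) = c_b(f,v,w) + Y_b(f; g−v, h−w)` — the slice law for triples whose
FIRST function does not depend on the sliced coordinate.  `pairStepLaw_of_sliceLaw`: it is a face of (SC); `threeCopySahi_of_pairStepLaw`:
it implies 3C-SAHI (its sub-face `v = g, w = h` is `0 ≤ c_b(f,g,h)`).  OPEN — an obligation / hypothesis, never a fact; a proof would be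
`PairStepLaw_holds`. [this work] [status: open] -/
@[conjecture] def PairStepLaw : Prop :=
  ∀ (d : ℕ) (b : Fin d → ℕ) (v w f g h : Pt d → ℝ), (∀ x, 0 ≤ v x) → (∀ x, 0 ≤ w x) → (∀ x, 0 ≤ f x) →
    (∀ x, v x ≤ g x) → (∀ x, w x ≤ h x) → Monotone v → Monotone w → Monotone f → Monotone g → Monotone h →
      0 ≤ scx b f v w f g h

/-- **(SC) ⇒ (PS)** (a face). [this work] -/
theorem pairStepLaw_of_sliceLaw (hSC : SliceLaw) : PairStepLaw := by
  intro d b v w f g h hv hw hf hvg hwh hvm hwm hfm hgm hhm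
  exact sliceLaw_iff_oneLevel.1 hSC d b f v w f g h hf hv hw (fun _ => le_rfl) hvg hwh hfm hvm hwm hfm hgm hhm

/-- **(PS) ⇒ 3C-SAHI**: the sub-face `v = g`, `w = h` of the pair-step law is `0 ≤ E_b(f,g,h|f,g,h) = c_b(f,g,h)`. [this work] -/
theorem threeCopySahi_of_pairStepLaw (hPS : PairStepLaw) : ThreeCopySahi := by
  intro d b f g h hf hg hh hfm hgm hhm
  have := hPS d b g h f g h hg hh hf (fun _ => le_rfl) (fun _ => le_rfl) hgm hhm hfm hgm hhm
  rwa [scx_diag] at this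

/-! ### §5 The lifting remark: any retention constant `λ < 3` suffices -/

/-- ★ **LIFTING**: if for some fixed real `λ < 3` every nonnegative monotone triple on every cube satisfies the retention bound
`λ·c_b(F¹,G¹,H¹) ≤ c_{(2,b)}(F,G,H)`, then 3C-SAHI holds: on the `x₀`-free lifts `c_{(2,b)} = 3c_b` (`tc_cons_two_lift`), so the bound
reads `λc ≤ 3c`.  (SC) is `λ = 2` (sharp); no induction on the dimension is needed, and the values `λ ≤ 0` give statements EQUIVALENT to
3C-SAHI. [this work] -/
theorem threeCopySahi_of_retention {lam : ℝ} (hlam : lam < 3)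
    (hret : ∀ (d : ℕ) (b : Fin d → ℕ) (F G H : Pt (d + 1) → ℝ), (∀ x, 0 ≤ F x) → (∀ x, 0 ≤ G x) → (∀ x, 0 ≤ H x) →
      Monotone F → Monotone G → Monotone H →
        lam * tc b (sec F true) (sec G true) (sec H true) ≤ tc (Fin.cons 2 b : Fin (d + 1) → ℕ) F G H) :
    ThreeCopySahi := by
  intro d b f g h hf hg hh hfm hgm hhm
  have hs : ∀ (u : Pt d → ℝ) (ε : Bool), sec (fun x : Pt (d + 1) => u (Fin.tail x)) ε = u := by
    intro u ε; funext x; simp [sec, Fin.tail_cons]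
  have lm : ∀ {u : Pt d → ℝ}, Monotone u → Monotone (fun x : Pt (d + 1) => u (Fin.tail x)) :=
    fun hu _ _ hxy => hu fun i => hxy i.succ
  have key := hret d b (fun x => f (Fin.tail x)) (fun x => g (Fin.tail x)) (fun x => h (Fin.tail x))
    (fun x => hf _) (fun x => hg _) (fun x => hh _) (lm hfm) (lm hgm) (lm hhm)
  rw [tc_cons_two_lift, hs, hs, hs] at key
  have h3 : 0 < 3 - lam := sub_pos.2 hlam
  by_contra hc
  have hc' : tc b f g h < 0 := not_le.mp hc
  have := mul_pos h3 (neg_pos.2 hc')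
  nlinarith

/-- In particular (SC) gives 3C-SAHI by lifting alone (cf. the inductive `threeCopySahi_of_sliceLaw`). [this work] -/
theorem threeCopySahi_of_sliceLaw' (hSC : SliceLaw) : ThreeCopySahi :=
  threeCopySahi_of_retention (lam := 2) (by norm_num) fun d b F G H hF hG hH hFm hGm hHm => hSC d b F G H hF hG hH hFm hGm hHm

/-! ### §6 Order two for contrast: exact superadditivity of the Harris gap over the sections -/

/-- **Order two, type-1 slice**: `H_{(1,b)}(F,G) = 2H_b(F⁰,G⁰) + H_b(F¹,G¹) + N_b(δF;δG;1)` for the three-copy Harris gap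
`H_b(f,g) = N_b(fg;1;1) − N_b(f;g;1)` (all data real). [this work] -/
theorem harris3_cons_one (b : Fin d → ℕ) (F G : Pt (d + 1) → ℝ) :
    N3 (Fin.cons 1 b : Fin (d + 1) → ℕ) (F * G) 1 1 - N3 (Fin.cons 1 b : Fin (d + 1) → ℕ) F G 1 =
      2 * (N3 b (sec F false * sec G false) 1 1 - N3 b (sec F false) (sec G false) 1)
      + (N3 b (sec F true * sec G true) 1 1 - N3 b (sec F true) (sec G true) 1)
      + N3 b (sec F true - sec F false) (sec G true - sec G false) 1 := by
  rw [N3_cons_one, N3_cons_one]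
  simp only [sec_mul, sec_one, N3_sub_left, N3_sub_mid]
  ring

/-- **Order two, type-2 slice**: `H_{(2,b)}(F,G) = H_b(F⁰,G⁰) + 2H_b(F¹,G¹) + N_b(δF;δG;1)` (all data real). [this work] -/
theorem harris3_cons_two (b : Fin d → ℕ) (F G : Pt (d + 1) → ℝ) :
    N3 (Fin.cons 2 b : Fin (d + 1) → ℕ) (F * G) 1 1 - N3 (Fin.cons 2 b : Fin (d + 1) → ℕ) F G 1 =
      (N3 b (sec F false * sec G false) 1 1 - N3 b (sec F false) (sec G false) 1)
      + 2 * (N3 b (sec F true * sec G true) 1 1 - N3 b (sec F true) (sec G true) 1)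
      + N3 b (sec F true - sec F false) (sec G true - sec G false) 1 := by
  rw [N3_cons_two, N3_cons_two]
  simp only [sec_mul, sec_one, N3_sub_left, N3_sub_mid]
  ring

/-- **Order three**: under (SC) the type-1 slice is superadditive over the two sections, `c_{(0,b)} + c_{(3,b)} ≤ c_{(1,b)}`
(`tc_cons_alt`: `c₁ − c₀ − c₃ = (c₂ − 2c₃) + N_b(δF;δG;δH)`).  At `x₀`-free lifts this reads `2c ≤ 3c`, so it is another sufficient
retention bound for 3C-SAHI. [this work] -/
theorem tc_cons_one_superadditive_of_sliceLaw (hSC : SliceLaw) (b : Fin d → ℕ) {F G H : Pt (d + 1) → ℝ} (hF : ∀ x, 0 ≤ F x)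
    (hG : ∀ x, 0 ≤ G x) (hH : ∀ x, 0 ≤ H x) (hFm : Monotone F) (hGm : Monotone G) (hHm : Monotone H) :
    tc (Fin.cons 0 b : Fin (d + 1) → ℕ) F G H + tc (Fin.cons 3 b : Fin (d + 1) → ℕ) F G H ≤
      tc (Fin.cons 1 b : Fin (d + 1) → ℕ) F G H := by
  have halt := tc_cons_alt b F G H
  have h3 : tc (Fin.cons 3 b : Fin (d + 1) → ℕ) F G H = tc b (sec F true) (sec G true) (sec H true) := tc_cons_three b F G H
  have hN : 0 ≤ N3 b (sec F true - sec F false) (sec G true - sec G false) (sec H true - sec H false) :=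
    N3_nonneg b (fun x => sub_nonneg.2 (sec_false_le_sec_true hFm x)) (fun x => sub_nonneg.2 (sec_false_le_sec_true hGm x))
      fun x => sub_nonneg.2 (sec_false_le_sec_true hHm x)
  have h2 := hSC d b F G H hF hG hH hFm hGm hHm
  linarith

end

end Summit.CriticalPhenomena.PercolationContinuityZ3.Theorems.SahiThreeCopy
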